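import Summits.MatrixMultiplication.MatrixMultiplication.Theorems.AbelianSTPPCensusShapeCertVPDefs

/-!
# Abelian STPP census — kernel evaluation of the vP certificate checker `ShapeCertVP` (C: orders 200–229)

Cell mm-stpp, route `AbelianSTPPCensusVP`, crux `ShapeExclusionVP337` (stmt-MatrixMultiplication-19191); support file
(no definitions).  `ShapeCertVP.checkV M = true` by `decide +kernel` (no `native_decide`, standard axioms), ONE theorem
per order so that every kernel evaluation starts with empty caches (measured in the seat folder: ≈ 4–8 s per order below
300, ≤ 35 s at the orders 300–337 — candidate-list construction plus the `feasP` packings of the visited nodes);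
`Elab.async false` keeps the evaluations of this file sequential (one kernel computation in memory at a time; tree
precedent `NeelSignC23EK0Cert4`).  The range lemma `checkV_200_229` at the end collects the file; the ten ranges are
assembled on `128 ≤ M ≤ 337` in `AbelianSTPPCensusVPShapeExclusionVP337.lean`, where `ShapeCertVP.checkV_sound`
(`…ShapeCertVPSearch`) and the bridge `ShapeCertVP.shapeExclusionVP_of_checkV` (`…ShapeCertVPFinal`) turn them into
the crux.
-/

set_option linter.dupNamespace false -- `MatrixMultiplication.MatrixMultiplication` (summit = problem, D-0017)
set_option autoImplicit false
set_option Elab.async false -- sequential kernel evaluations (memory high-water of one order at a time)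

namespace Summit.MatrixMultiplication.MatrixMultiplication.Theorems.ShapeCertVP

set_option maxHeartbeats 0 in
/-- certificate check at order `200` (kernel evaluation) -/
theorem checkV_200 : checkV 200 = true := by
  decide +kernel

set_option maxHeartbeats 0 in
/-- certificate check at order `201` (kernel evaluation) -/
theorem checkV_201 : checkV 201 = true := by
  decide +kernel

set_option maxHeartbeats 0 in
/-- certificate check at order `202` (kernel evaluation) -/
theorem checkV_202 : checkV 202 = true := by
  decide +kernel

set_option maxHeartbeats 0 in
/-- certificate check at order `203` (kernel evaluation) -/
theorem checkV_203 : checkV 203 = true := by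
  decide +kernel

set_option maxHeartbeats 0 in
/-- certificate check at order `204` (kernel evaluation) -/
theorem checkV_204 : checkV 204 = true := by
  decide +kernel

set_option maxHeartbeats 0 in
/-- certificate check at order `205` (kernel evaluation) -/
theorem checkV_205 : checkV 205 = true := by
  decide +kernel

set_option maxHeartbeats 0 in
/-- certificate check at order `206` (kernel evaluation) -/
theorem checkV_206 : checkV 206 = true := by
  decide +kernel

set_option maxHeartbeats 0 in
/-- certificate check at order `207` (kernel evaluation) -/
theorem checkV_207 : checkV 207 = true := by
  decide +kernel

set_option maxHeartbeats 0 in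
/-- certificate check at order `208` (kernel evaluation) -/
theorem checkV_208 : checkV 208 = true := by
  decide +kernel

set_option maxHeartbeats 0 in
/-- certificate check at order `209` (kernel evaluation) -/
theorem checkV_209 : checkV 209 = true := by
  decide +kernel

set_option maxHeartbeats 0 in
/-- certificate check at order `210` (kernel evaluation) -/
theorem checkV_210 : checkV 210 = true := by
  decide +kernel

set_option maxHeartbeats 0 in
/-- certificate check at order `211` (kernel evaluation) -/
theorem checkV_211 : checkV 211 = true := by
  decide +kernel

set_option maxHeartbeats 0 in
/-- certificate check at order `212` (kernel evaluation) -/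
theorem checkV_212 : checkV 212 = true := by
  decide +kernel

set_option maxHeartbeats 0 in
/-- certificate check at order `213` (kernel evaluation) -/
theorem checkV_213 : checkV 213 = true := by
  decide +kernel

set_option maxHeartbeats 0 in
/-- certificate check at order `214` (kernel evaluation) -/
theorem checkV_214 : checkV 214 = true := by
  decide +kernel

set_option maxHeartbeats 0 in
/-- certificate check at order `215` (kernel evaluation) -/
theorem checkV_215 : checkV 215 = true := by
  decide +kernel

set_option maxHeartbeats 0 in
/-- certificate check at order `216` (kernel evaluation) -/
theorem checkV_216 : checkV 216 = true := by
  decide +kernel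

set_option maxHeartbeats 0 in
/-- certificate check at order `217` (kernel evaluation) -/
theorem checkV_217 : checkV 217 = true := by
  decide +kernel

set_option maxHeartbeats 0 in
/-- certificate check at order `218` (kernel evaluation) -/
theorem checkV_218 : checkV 218 = true := by
  decide +kernel

set_option maxHeartbeats 0 in
/-- certificate check at order `219` (kernel evaluation) -/
theorem checkV_219 : checkV 219 = true := by
  decide +kernel

set_option maxHeartbeats 0 in
/-- certificate check at order `220` (kernel evaluation) -/
theorem checkV_220 : checkV 220 = true := by
  decide +kernel

set_option maxHeartbeats 0 in
/-- certificate check at order `221` (kernel evaluation) -/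
theorem checkV_221 : checkV 221 = true := by
  decide +kernel

set_option maxHeartbeats 0 in
/-- certificate check at order `222` (kernel evaluation) -/
theorem checkV_222 : checkV 222 = true := by
  decide +kernel

set_option maxHeartbeats 0 in
/-- certificate check at order `223` (kernel evaluation) -/
theorem checkV_223 : checkV 223 = true := by
  decide +kernel

set_option maxHeartbeats 0 in
/-- certificate check at order `224` (kernel evaluation) -/
theorem checkV_224 : checkV 224 = true := by
  decide +kernel

set_option maxHeartbeats 0 in
/-- certificate check at order `225` (kernel evaluation) -/
theorem checkV_225 : checkV 225 = true := by
  decide +kernel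

set_option maxHeartbeats 0 in
/-- certificate check at order `226` (kernel evaluation) -/
theorem checkV_226 : checkV 226 = true := by
  decide +kernel

set_option maxHeartbeats 0 in
/-- certificate check at order `227` (kernel evaluation) -/
theorem checkV_227 : checkV 227 = true := by
  decide +kernel

set_option maxHeartbeats 0 in
/-- certificate check at order `228` (kernel evaluation) -/
theorem checkV_228 : checkV 228 = true := by
  decide +kernel

set_option maxHeartbeats 0 in
/-- certificate check at order `229` (kernel evaluation) -/
theorem checkV_229 : checkV 229 = true := by
  decide +kernel

/-- **The vP certificate holds at every order `200 ≤ M ≤ 229`** (collects the evaluations of this file). -/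
theorem checkV_200_229 (M : ℕ) (h₁ : 200 ≤ M) (h₂ : M ≤ 229) : checkV M = true := by
  interval_cases M
  · exact checkV_200
  · exact checkV_201
  · exact checkV_202
  · exact checkV_203
  · exact checkV_204
  · exact checkV_205
  · exact checkV_206
  · exact checkV_207
  · exact checkV_208
  · exact checkV_209
  · exact checkV_210
  · exact checkV_211
  · exact checkV_212
  · exact checkV_213
  · exact checkV_214
  · exact checkV_215
  · exact checkV_216
  · exact checkV_217
  · exact checkV_218
  · exact checkV_219
  · exact checkV_220
  · exact checkV_221
  · exact checkV_222
  · exact checkV_223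
  · exact checkV_224
  · exact checkV_225
  · exact checkV_226
  · exact checkV_227
  · exact checkV_228
  · exact checkV_229

end Summit.MatrixMultiplication.MatrixMultiplication.Theorems.ShapeCertVP
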